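import Literature.MathematicalPhysics.QuantumFieldTheory.ConformalBootstrap3D.MixedCertificateObligations

/-!
# The signed `σεσε` family of a mixed `σ–ε` point certificate changes sign in the odd tail

`MixedCertificateObligations` reduces the odd-sector obligation at a regular `(Δ, ℓ)` to the level
series of `oddTermForm`, whose `(m, j)` term is
`(-1)^ℓ A_{m,j}(-c,c)·Φ³(E,j) + A_{m,j}(c,c)·(Φ⁴₋ - Φ⁵₊)(E,j)`, `c = (Δ_σ-Δ_ε)/2`, `E = Δ + m`
(`A(c,c) ≥ 0` always, `hrCoeffAB_self_nonneg`; the spin-parity sign sits on the `σεσε` family —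
ERRATUM 2026-08-19 of `SigmaEpsilonData.SatisfiesCrossing`; an earlier reading of this file had it on
the `εσσε` family). This file records the SIGN STRUCTURE of the signed family as a theorem: for EVERY
spin `ℓ ≥ 1` the level-one spin-down coefficient `A_{1,ℓ-1}(-c,c; Δ, ℓ)` of the `σεσε` array is
STRICTLY NEGATIVE on the whole twist window `ℓ + 1 < Δ < ℓ + 1 + |Δ_σ - Δ_ε|` (width `≈ 0.894` at the
Ising point), a window that lies inside the tail `Δ ≥ E₀` for every `ℓ ≥ E₀ - 1`, of either parity,
while `A_{0,ℓ}(-c,c) = 1 > 0`. Consequence for certificate design (a precise negative result, not an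
impossibility claim): the `σεσε` contribution `(-1)^ℓ A(-c,c) Φ³` to the odd term is NOT sign-definite
in the tail for any fixed sign pattern of `Φ³`, so a termwise odd-tail rule cannot use the `σεσε`
channel as a source of positivity; it has to be the DOMINATION inequality
`A_{m,j}(c,c)·(Φ⁴₋ - Φ⁵₊) ≥ |A_{m,j}(-c,c)|·|Φ³|` of `oddTermForm_nonneg_of_abs_le` (the
reflection-positive `εσσε` entries dominate, uniformly in the parity of `ℓ`), with `|A(-c,c)|`
controlled by level-grouped bounds (`MixedBlockCauchySchwarz`: `|g⁻⁻ - head| ≤ √(tail(c,c)·tail(-c,-c))`)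
or by large-`Δ` asymptotics with a certified remainder; coefficientwise the signed family is NOT small
against the positive one (`|A_{3,0}(-c,c)| / A_{3,0}(c,c) ≈ 52.3` at `ℓ = 1`, `Δ = 3`, Ising `c`;
pub-ising3d code/typer-g3/ab_signs.py). Closed form: Dolan–Osborn 2004 §3 (3.11)–(3.12) at level one
(`hrCoeffAB_one_pred`).
[cite: DolanOsborn2004, §3 eqs. (3.11)–(3.12)]
-/

namespace Literature.MathematicalPhysics.QuantumFieldTheory.ConformalBootstrap3D

/-- **The `σεσε` level-one spin-down coefficient is negative just above the unitarity bound.**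
For `ℓ ≥ 1` and `ℓ + 1 < Δ < ℓ + 1 + |d|` (`d = Δ_σ - Δ_ε`):
`A_{1,ℓ-1}(-d/2, d/2; Δ, ℓ) = ((Δ-ℓ-1)² - d²)·ℓ / (2(2ℓ+1)(Δ-ℓ-1)) < 0`.
[cite: DolanOsborn2004, §3 eqs. (3.11)–(3.12)] -/
theorem hrCoeffAB_antisym_one_pred_neg {d Δ : ℝ} {ℓ : ℕ} (hℓ : 1 ≤ ℓ) (h1 : (ℓ : ℝ) + 1 < Δ)
    (h2 : Δ < (ℓ : ℝ) + 1 + |d|) : hrCoeffAB (-d / 2) (d / 2) Δ ℓ 1 (ℓ - 1) < 0 := by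
  have hΔ : Δ - (ℓ : ℝ) - 1 ≠ 0 := by intro h; linarith
  rw [hrCoeffAB_one_pred hℓ hΔ]
  have hnum : (Δ - ℓ - 1 + 2 * (-d / 2)) * (Δ - ℓ - 1 + 2 * (d / 2)) = (Δ - ℓ - 1) ^ 2 - d ^ 2 := by
    ring
  rw [hnum]
  have hden : 0 < 2 * (2 * (ℓ : ℝ) + 1) * (Δ - ℓ - 1) := by
    have : (0 : ℝ) < Δ - ℓ - 1 := by linarith
    positivity
  have hℓpos : (0 : ℝ) < (ℓ : ℝ) := by exact_mod_cast hℓ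
  have hsq : (Δ - ℓ - 1) ^ 2 < d ^ 2 := by
    have h0 : 0 < Δ - ℓ - 1 := by linarith
    have hlt : Δ - ℓ - 1 < |d| := by linarith
    calc (Δ - ℓ - 1) ^ 2 < |d| ^ 2 := by exact pow_lt_pow_left₀ hlt h0.le two_ne_zero
      _ = d ^ 2 := sq_abs d
  exact div_neg_of_neg_of_pos (mul_neg_of_neg_of_pos (by linarith) hℓpos) hden

/-- The same coefficient as it appears in `oddTermForm` (`a = -(Δ_σ-Δ_ε)/2`, `b = (Δ_σ-Δ_ε)/2`):
negative at `(m, j) = (1, ℓ-1)` for every `ℓ ≥ 1`, `ℓ + 1 < Δ < ℓ + 1 + |Δ_σ - Δ_ε|`.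
[cite: DolanOsborn2004, §3 eqs. (3.11)–(3.12)] -/
theorem hrCoeffAB_sigmaEps_one_pred_neg {Δσ Δε Δ : ℝ} {ℓ : ℕ} (hℓ : 1 ≤ ℓ)
    (h1 : (ℓ : ℝ) + 1 < Δ) (h2 : Δ < (ℓ : ℝ) + 1 + |Δσ - Δε|) :
    hrCoeffAB (-(Δσ - Δε) / 2) ((Δσ - Δε) / 2) Δ ℓ 1 (ℓ - 1) < 0 := by
  have h := hrCoeffAB_antisym_one_pred_neg (d := Δσ - Δε) hℓ h1 h2
  simpa [neg_div] using h

/-- Whereas the `εσσε` array entering the same term is non-negative there (as everywhere above the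
bound): the obstruction is the SIGN of `A(-c,c)`, not a pole. [cite: DolanOsborn2004, §3 eq. (3.11)] -/
theorem hrCoeffAB_sigmaEps_self_one_pred_nonneg {Δσ Δε Δ : ℝ} {ℓ : ℕ} (h1 : unitarityBound3D ℓ < Δ) :
    0 ≤ hrCoeffAB ((Δσ - Δε) / 2) ((Δσ - Δε) / 2) Δ ℓ 1 (ℓ - 1) :=
  hrCoeffAB_self_nonneg _ h1 _ _

end Literature.MathematicalPhysics.QuantumFieldTheory.ConformalBootstrap3D
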